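import Mathlib
import Literature.Analysis.FluidPDE.SuitableWeak
import Literature.Analysis.FluidPDE.SuitableWeakRightContinuity
import Literature.Analysis.FluidPDE.CKNVelocityIntegrability
import Literature.Analysis.FluidPDE.SelfSimilarCollapseAnsatz
import Literature.Analysis.FluidPDE.SereginZajaczkowski2007SwirlProofs
import Summits.NavierStokesRegularity.NavierStokesRegularity.Theses.EulerZoomLiouville
import HarnessLib

/-!
# Rung C1 of the crux `EulerZoomLiouville.PowerGaugeEulerLiouville`: the local energy
# inequality of the class in PROFILE variables for exactly self-similar members

Route №10 `EulerZoomLiouville` (NavierStokesRegularity), crux E = stmt-NavierStokesRegularity-19832.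
Tenure rung C1 (`Cruxes/PowerGaugeEulerLiouville/Lines/rungC_window.lean`, `Sig.rungC1_selfSimilar`):
exactly self-similar members `u(τ, x) = (−τ)^{γ−1} V((−τ)^{−γ} x)`,
`p(τ, x) = (−τ)^{2(γ−1)} P((−τ)^{−γ} x)`, `γ = 1/(2+ρ)` (tree `selfSimilarCollapse γ 0 V`,
`selfSimilarCollapsePressure γ 0 P`), of Seregin's power-gauged ancient Euler class vanish.
In the window `0 < ρ ≤ 1/2` (Chae–Shvydkoy `α = 1+ρ ∈ (1, 3/2]`) this is open in print.

This file types the LEI-FLUX LEVER of the class in profile variables — the starting relation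
(2.9) of Chae–Shvydkoy (ARMA 209 (2013) = arXiv:1201.6009, §2.2) — for members of E's class:

* `locallyIntegrableOn_cube_of_suitable` — every suitable weak Euler pair on the slab has
  `|u|³ ∈ L¹_loc` (energy class + `∇u ∈ L²_loc` ⇒ `u ∈ L^{10/3}_loc`, tree
  `lintegral_rpow_ten_thirds_lt_top_of_energy`); reusable by every stratum of the crux.
* `ae_energy_le_add_flux` — the two-time local energy inequality of a class member against a
  time-independent test `σ ≥ 0`: for a.e. `τ₁ < 0` and a.e. `τ₂ ∈ (τ₁, 0)`,
  `∫ |u(τ₂)|² σ ≤ ∫ |u(τ₁)|² σ + ∫∫_{[τ₁,τ₂) × ℝ³} (|u|² + 2p) ⟪u, ∇σ⟫`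
  (tree `ae_energy_le_of_start_Ioo`, CKN (2.5) sliced twice). ONLY THIS FORWARD DIRECTION holds
  in the class (local energy INEQUALITY): of CS13's two-sided (2.9) the direction used in their
  Thm 3.1 / §3.2.2 survives, the one used in §3.2.1 ((3.2): small scales bounded by the tail)
  does not.
* `integral_norm_sq_selfSimilar_mul`, `integral_flux_selfSimilar` — the self-similar change of
  variables of the slice energy and of the flux slice:
  `∫ |u(τ)|² σ = s^{5γ−2} ∫ |V(y)|² σ(s^γ y) dy`, `∫ (|u|²+2p)⟪u,∇σ⟫(τ) = s^{6γ−3} ∫ (|V|²+2P)(y)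
  ⟪V(y), ∇σ(s^γ y)⟫ dy`, `s = −τ` (note `s^{5γ−2} = l^{2ρ−1}` for `l = s^{−γ}`).
* `selfSimilar_profile_energy_le_add_flux` — the assembled PROFILE LEI (forward direction) for
  exactly self-similar members of the class, in the time variables `τ₁ < τ₂ < 0`.

WHAT THIS IS NOT: not NS, not E, not rung C1 — the reduction of C1's Euler input to a profile
inequality; the profile Liouville theorem in the window remains open (Chae–Shvydkoy's window).
-/

noncomputable section

set_option linter.dupNamespace false

open MeasureTheory Set Filter Topology Metric Function TopologicalSpace
open scoped ENNReal NNReal InnerProductSpace RealInnerProductSpace Laplacian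

namespace Summit.NavierStokesRegularity.NavierStokesRegularity.Theorems.PowerGaugeEulerLiouville

open Literature.Analysis Literature.Analysis.FunctionSpaces Literature.Analysis.FluidPDE

/-! ## `|u|³ ∈ L¹_loc` for suitable weak Euler pairs on the slab -/

section Cube

/-- **Suitable weak pairs on the slab have `|u|³ ∈ L¹_loc`.**  A suitable weak solution of the
(Euler or Navier–Stokes, any `ν`) system on the slab `(−∞, 0) × ℝ³` (energy class `L^∞_t L²_x`
locally and `∇u ∈ L²_loc`, CKN (2.1)) satisfies `∫∫_K |u|³ < ∞` on every compact `K` of the slab: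
`u ∈ L^{10/3}_loc` by the tree's `lintegral_rpow_ten_thirds_lt_top_of_energy`
(Lemarié-Rieusset 2016, (13.17)–(13.18)) on a cylinder containing `K`, and `a³ ≤ 1 + a^{10/3}`
(tree `SereginZajaczkowski2007.pow_three_le_one_add_rpow`).
[cite: LemarieRieusset2016, (13.17)–(13.18) p. 461] -/
theorem locallyIntegrableOn_cube_of_suitable {ν : ℝ}
    {u : ℝ → EuclideanSpace ℝ (Fin 3) → EuclideanSpace ℝ (Fin 3)}
    {p : ℝ → EuclideanSpace ℝ (Fin 3) → ℝ}
    (hsw : IsSuitableWeakSolutionOn (slab (EuclideanSpace ℝ (Fin 3)) (Iio 0) isOpen_Iio) ν 0 u p) :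
    LocallyIntegrableOn (fun z : ℝ × EuclideanSpace ℝ (Fin 3) => ‖u z.1 z.2‖ ^ 3)
      ((slab (EuclideanSpace ℝ (Fin 3)) (Iio 0) isOpen_Iio : Opens (ℝ × EuclideanSpace ℝ (Fin 3))) :
        Set (ℝ × EuclideanSpace ℝ (Fin 3))) volume := by
  set S : Opens (ℝ × EuclideanSpace ℝ (Fin 3)) :=
    slab (EuclideanSpace ℝ (Fin 3)) (Iio 0) isOpen_Iio with hSdef
  have hSo : IsOpen ((S : Opens (ℝ × EuclideanSpace ℝ (Fin 3))) : Set (ℝ × EuclideanSpace ℝ (Fin 3))) :=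
    S.isOpen
  refine (locallyIntegrableOn_iff hSo.isLocallyClosed).2 fun K hKS hK => ?_
  rcases K.eq_empty_or_nonempty with hKe | hKne
  · rw [hKe]; exact integrableOn_empty
  -- a box `Icc (−R₀) tmax ×ˢ closedBall 0 R₀ ⊇ K` with `tmax < 0`
  obtain ⟨zm, hzmK, hzm⟩ := hK.exists_isMaxOn hKne continuous_fst.continuousOn
  have htmax : zm.1 < 0 := by simpa [hSdef] using hKS hzmK
  obtain ⟨R₀, hR₀⟩ := hK.isBounded.subset_closedBall (0 : ℝ × EuclideanSpace ℝ (Fin 3))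
  set a : ℝ := -(|R₀| + 1) with ha
  set b : ℝ := zm.1 / 2 with hb
  have hb0 : b < 0 := by rw [hb]; linarith
  set R : ℝ := |R₀| + 1 with hR
  have hRpos : 0 < R := by positivity
  have hKbox : K ⊆ Ioo a b ×ˢ ball (0 : EuclideanSpace ℝ (Fin 3)) R := by
    intro z hz
    have h1 : ‖z‖ ≤ R₀ := by simpa using hR₀ hz
    have h2 : ‖z.1‖ ≤ R₀ := (norm_fst_le z).trans h1
    have h3 : ‖z.2‖ ≤ R₀ := (norm_snd_le z).trans h1
    have h4 : z.1 ≤ zm.1 := hzm hz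
    refine mem_prod.2 ⟨⟨?_, ?_⟩, ?_⟩
    · rw [ha]; have := neg_le_of_abs_le (h2.trans (le_abs_self R₀)); rw [Real.norm_eq_abs] at h2
      linarith [abs_nonneg z.1, neg_abs_le z.1, le_abs_self R₀]
    · linarith
    · rw [mem_ball, dist_zero_right, hR]; linarith [le_abs_self R₀]
  -- the open cylinder `Ω = (a, b) × B(0, R)` and a compact `K' ⊇ Ω` inside the slab
  set Ω : Opens (ℝ × EuclideanSpace ℝ (Fin 3)) :=
    ⟨Ioo a b ×ˢ ball (0 : EuclideanSpace ℝ (Fin 3)) R, isOpen_Ioo.prod isOpen_ball⟩ with hΩ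
  set K' : Set (ℝ × EuclideanSpace ℝ (Fin 3)) :=
    Icc a b ×ˢ closedBall (0 : EuclideanSpace ℝ (Fin 3)) R with hK'
  have hK'c : IsCompact K' := isCompact_Icc.prod (isCompact_closedBall _ _)
  have hΩK' : ((Ω : Opens (ℝ × EuclideanSpace ℝ (Fin 3))) : Set (ℝ × EuclideanSpace ℝ (Fin 3))) ⊆ K' :=
    prod_mono Ioo_subset_Icc_self ball_subset_closedBall
  have hK'S : K' ⊆ ((S : Opens (ℝ × EuclideanSpace ℝ (Fin 3))) : Set (ℝ × EuclideanSpace ℝ (Fin 3))) := by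
    rintro ⟨t, x⟩ ⟨ht, -⟩
    simp only [hSdef, SetLike.mem_coe, mem_slab, mem_Iio]
    exact lt_of_le_of_lt ht.2 hb0
  have hΩS : Ω ≤ S := fun z hz => hK'S (hΩK' hz)
  -- the energy bound on `Ω`
  have hE : ∃ C : ℝ≥0, ∀ᵐ t : ℝ, ∫⁻ x,
      ((Ω : Opens (ℝ × EuclideanSpace ℝ (Fin 3))) : Set (ℝ × EuclideanSpace ℝ (Fin 3))).indicator
        (fun z : ℝ × EuclideanSpace ℝ (Fin 3) => ‖u z.1 z.2‖ₑ ^ 2) (t, x) ≤ C := by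
    obtain ⟨C, hC⟩ := hsw.energyClass K' hK'S hK'c
    refine ⟨C, ?_⟩
    filter_upwards [hC] with t ht
    refine le_trans (lintegral_mono fun x => ?_) ht
    exact indicator_le_indicator_of_subset hΩK' (fun _ => zero_le) _
  -- the gradient of the structure and its square integrability on `Ω`
  obtain ⟨G, hG, hGsq, -⟩ := hsw.localEnergy
  have hGΩ : HasWeakSpatialGradientOn Ω u G := hG.mono hΩS
  have hGsqΩ : ∫⁻ z in ((Ω : Opens (ℝ × EuclideanSpace ℝ (Fin 3))) : Set (ℝ × EuclideanSpace ℝ (Fin 3))),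
      ENNReal.ofReal (frobeniusNormSq (G z.1 z.2)) < ∞ :=
    lt_of_le_of_lt (lintegral_mono_set hΩK') (hGsq K' hK'S hK'c)
  -- `u ∈ L^{10/3}(Ω)`
  have h103 := lintegral_rpow_ten_thirds_lt_top_of_energy (finrank_euclideanSpace_fin (𝕜 := ℝ) (n := 3))
    hE hGΩ hGsqΩ (a := a) (b := b) (xB := 0) (R := R) subset_rfl
  -- measurability of `u` on the slab
  have hum : AEStronglyMeasurable (uncurry u)
      (volume.restrict (Ioo a b ×ˢ ball (0 : EuclideanSpace ℝ (Fin 3)) R)) :=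
    hGΩ.locallyIntegrableOn.aestronglyMeasurable
  -- conclusion on `K ⊆ Ω`
  have hfin : ∫⁻ z in Ioo a b ×ˢ ball (0 : EuclideanSpace ℝ (Fin 3)) R, ‖u z.1 z.2‖ₑ ^ 3 < ∞ := by
    have hvol : volume (Ioo a b ×ˢ ball (0 : EuclideanSpace ℝ (Fin 3)) R) < ∞ :=
      (hK'c.measure_lt_top (μ := volume)).trans_le' (measure_mono hΩK')
    calc ∫⁻ z in Ioo a b ×ˢ ball (0 : EuclideanSpace ℝ (Fin 3)) R, ‖u z.1 z.2‖ₑ ^ 3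
        ≤ ∫⁻ z in Ioo a b ×ˢ ball (0 : EuclideanSpace ℝ (Fin 3)) R, (1 + ‖u z.1 z.2‖ₑ ^ (10 / 3 : ℝ)) :=
          lintegral_mono fun z => SereginZajaczkowski2007.pow_three_le_one_add_rpow _
      _ = volume (Ioo a b ×ˢ ball (0 : EuclideanSpace ℝ (Fin 3)) R) +
            ∫⁻ z in Ioo a b ×ˢ ball (0 : EuclideanSpace ℝ (Fin 3)) R, ‖u z.1 z.2‖ₑ ^ (10 / 3 : ℝ) := by
          rw [lintegral_add_left' aemeasurable_const, lintegral_const, Measure.restrict_apply_univ,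
            one_mul]
      _ < ∞ := ENNReal.add_lt_top.2 ⟨hvol, h103⟩
  have hint : IntegrableOn (fun z : ℝ × EuclideanSpace ℝ (Fin 3) => ‖u z.1 z.2‖ ^ 3)
      (Ioo a b ×ˢ ball (0 : EuclideanSpace ℝ (Fin 3)) R) volume := by
    refine ⟨(hum.norm.pow 3), ?_⟩
    rw [HasFiniteIntegral]
    refine lt_of_le_of_lt (le_of_eq (lintegral_congr fun z => ?_)) hfin
    rw [Real.enorm_eq_ofReal (by positivity), ENNReal.ofReal_pow (norm_nonneg _), ofReal_norm]
  exact hint.mono_set hKbox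

end Cube

/-! ## The two-time local energy inequality of the class (forward direction only) -/

section TwoTimes

/-- **Two-time local energy inequality on the slab.**  For a suitable weak pair `(u, p)` on
`(−∞, 0) × ℝ³` (viscosity `ν ≥ 0`, no force) and a smooth compactly supported `σ = σ(x) ≥ 0`:
for a.e. `τ₁ < 0` and then a.e. `τ₂ ∈ (τ₁, 0)`,
`∫ |u(τ₂)|² σ ≤ ∫ |u(τ₁)|² σ + ∫∫_{[τ₁,τ₂) × ℝ³} (|u|² νΔσ + (|u|² + 2p) ⟪u, ∇σ⟫)`
(the tree's `ae_energy_le_of_start_Ioo`, CKN (2.5), exhausted over the windows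
`(−n−1, −1/(k+1))`).  The class gives ONLY this direction (energy at the later time bounded by the
earlier one plus flux) — Chae–Shvydkoy's (2.9) is two-sided because they assume the local energy
EQUALITY. [cite: CaffarelliKohnNirenberg1982, §2 (2.5)] -/
theorem ae_energy_le_add_flux {ν : ℝ} (hν : 0 ≤ ν)
    {u : ℝ → EuclideanSpace ℝ (Fin 3) → EuclideanSpace ℝ (Fin 3)}
    {p : ℝ → EuclideanSpace ℝ (Fin 3) → ℝ}
    (hsw : IsSuitableWeakSolutionOn (slab (EuclideanSpace ℝ (Fin 3)) (Iio 0) isOpen_Iio) ν 0 u p)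
    {σ : EuclideanSpace ℝ (Fin 3) → ℝ} (hσ : ContDiff ℝ (⊤ : ℕ∞) σ) (hσc : HasCompactSupport σ)
    (hσ0 : ∀ x, 0 ≤ σ x) :
    ∀ᵐ τ₁ : ℝ, τ₁ < 0 → ∀ᵐ τ₂ : ℝ, τ₂ ∈ Ioo τ₁ 0 →
      ∫ x, ‖u τ₂ x‖ ^ 2 * σ x ≤ (∫ x, ‖u τ₁ x‖ ^ 2 * σ x) +
        ∫ z in Ico τ₁ τ₂ ×ˢ (univ : Set (EuclideanSpace ℝ (Fin 3))),
          (‖u z.1 z.2‖ ^ 2 * (ν * Δ σ z.2) +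
            (‖u z.1 z.2‖ ^ 2 + 2 * p z.1 z.2) * ⟪u z.1 z.2, gradient σ z.2⟫) := by
  have hu3 := locallyIntegrableOn_cube_of_suitable hsw
  -- the windows `(−n−1, −1/(k+1))`
  have key : ∀ n k : ℕ, ∀ᵐ s₀ : ℝ, s₀ ∈ Ioo (-(n : ℝ) - 1) (-(1 / ((k : ℝ) + 1))) →
      ∀ᵐ t : ℝ, t ∈ Ioo s₀ (-(1 / ((k : ℝ) + 1))) →
        ∫ x, ‖u t x‖ ^ 2 * σ x ≤ (∫ x, ‖u s₀ x‖ ^ 2 * σ x) +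
          ∫ z in Ico s₀ t ×ˢ (univ : Set (EuclideanSpace ℝ (Fin 3))),
            (‖u z.1 z.2‖ ^ 2 * (ν * Δ σ z.2) +
              (‖u z.1 z.2‖ ^ 2 + 2 * p z.1 z.2) * ⟪u z.1 z.2, gradient σ z.2⟫) := by
    intro n k
    have hk : (0 : ℝ) < 1 / ((k : ℝ) + 1) := Nat.one_div_pos_of_nat
    refine SuitableRestart.ae_energy_le_of_start_Ioo hsw hν hu3 (a := -(n : ℝ) - 2) (b := 0) ?_ hσ hσc hσ0
      (by linarith) (by linarith)
    rintro ⟨t, x⟩ ⟨ht, -⟩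
    rw [SetLike.mem_coe, mem_slab]
    exact ht.2
  have H := ae_all_iff.2 fun n : ℕ => ae_all_iff.2 fun k : ℕ => key n k
  filter_upwards [H] with s₀ hs₀ hneg
  -- for every `k` with `s₀ < −1/(k+1)`: the conclusion for a.e. `t ∈ (s₀, −1/(k+1))`
  have H2 : ∀ k : ℕ, ∀ᵐ t : ℝ, s₀ < -(1 / ((k : ℝ) + 1)) → t ∈ Ioo s₀ (-(1 / ((k : ℝ) + 1))) →
      ∫ x, ‖u t x‖ ^ 2 * σ x ≤ (∫ x, ‖u s₀ x‖ ^ 2 * σ x) +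
        ∫ z in Ico s₀ t ×ˢ (univ : Set (EuclideanSpace ℝ (Fin 3))),
          (‖u z.1 z.2‖ ^ 2 * (ν * Δ σ z.2) +
            (‖u z.1 z.2‖ ^ 2 + 2 * p z.1 z.2) * ⟪u z.1 z.2, gradient σ z.2⟫) := by
    intro k
    by_cases hk : s₀ < -(1 / ((k : ℝ) + 1))
    · obtain ⟨n, hn⟩ := exists_nat_gt (-s₀)
      have hmem : s₀ ∈ Ioo (-(n : ℝ) - 1) (-(1 / ((k : ℝ) + 1))) := ⟨by linarith, hk⟩
      filter_upwards [hs₀ n k hmem] with t ht _ htI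
      exact ht htI
    · exact Eventually.of_forall fun t h => absurd h hk
  have H3 := ae_all_iff.2 H2
  filter_upwards [H3] with t ht htI
  obtain ⟨k, hk⟩ := exists_nat_one_div_lt (neg_pos.2 htI.2)
  have hk' : t < -(1 / ((k : ℝ) + 1)) := by linarith
  exact ht k (htI.1.trans hk') ⟨htI.1, hk'⟩

end TwoTimes

/-! ## The self-similar change of variables in the slice energy and the flux slice -/

section Scaling

/-- `|(R³)⁻¹| = s^{3γ}` for `R = s^{−γ}`, `s > 0`: the Jacobian of `x = s^{γ} y` on `ℝ³`. [folklore] -/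
theorem abs_inv_rpow_neg_pow_three {s : ℝ} (hs : 0 < s) (γ : ℝ) :
    |((s ^ (-γ)) ^ 3)⁻¹| = s ^ (3 * γ) := by
  have h1 : (s ^ (-γ)) ^ 3 = s ^ (-(3 * γ)) := by
    rw [← Real.rpow_natCast, ← Real.rpow_mul hs.le]
    congr 1; push_cast; ring
  rw [h1, Real.rpow_neg hs.le, inv_inv, abs_of_pos (Real.rpow_pos_of_pos hs _)]

/-- `s^{γ} • (s^{−γ} • x) = x`, `s > 0`. [folklore] -/
theorem rpow_smul_rpow_neg_smul {s : ℝ} (hs : 0 < s) (γ : ℝ) (x : EuclideanSpace ℝ (Fin 3)) :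
    s ^ γ • (s ^ (-γ) • x) = x := by
  rw [smul_smul, Real.rpow_neg hs.le, mul_inv_cancel₀ (Real.rpow_pos_of_pos hs γ).ne', one_smul]

/-- **Slice energy of the ansatz against a test function (exact scaling).**  For `τ < 0`,
`∫ |u(τ,x)|² σ(x) dx = (−τ)^{5γ−2} ∫ |V(y)|² σ((−τ)^{γ} y) dy` for
`u = selfSimilarCollapse γ 0 V` (change of variables `x = (−τ)^γ y` on `ℝ³`; Chae–Shvydkoy 2013,
(2.8): with `γ = 1/(1+α)` the exponent is `(N−2α)/(1+α)·γ… = 5γ−2`, i.e. `l^{2α−N}` for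
`l = (−τ)^{−γ}`). [cite: ChaeShvydkoy2013, §2.2 eq. (2.8)] -/
theorem integral_norm_sq_selfSimilarCollapse_mul (γ : ℝ) {τ : ℝ} (hτ : τ < 0)
    (V : EuclideanSpace ℝ (Fin 3) → EuclideanSpace ℝ (Fin 3)) (σ : EuclideanSpace ℝ (Fin 3) → ℝ) :
    ∫ x, ‖selfSimilarCollapse γ 0 V τ x‖ ^ 2 * σ x =
      (-τ) ^ (5 * γ - 2) * ∫ y, ‖V y‖ ^ 2 * σ ((-τ) ^ γ • y) := by
  have hs : 0 < -τ := neg_pos.2 hτ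
  have h1 : ∀ x, ‖selfSimilarCollapse γ 0 V τ x‖ ^ 2 * σ x =
      (-τ) ^ (2 * (γ - 1)) * (‖V ((-τ) ^ (-γ) • x)‖ ^ 2 * σ x) := by
    intro x
    rw [norm_selfSimilarCollapse hτ, zero_sub, mul_pow, ← Real.rpow_natCast ((-τ) ^ (γ - 1)) 2,
      ← Real.rpow_mul hs.le, show (γ - 1) * ((2 : ℕ) : ℝ) = 2 * (γ - 1) by push_cast; ring]
    ring
  simp_rw [h1]
  rw [integral_const_mul]
  have h2 : ∫ x, ‖V ((-τ) ^ (-γ) • x)‖ ^ 2 * σ x =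
      (-τ) ^ (3 * γ) * ∫ y, ‖V y‖ ^ 2 * σ ((-τ) ^ γ • y) := by
    have key := Measure.integral_comp_smul (volume : Measure (EuclideanSpace ℝ (Fin 3)))
      (fun y : EuclideanSpace ℝ (Fin 3) => ‖V y‖ ^ 2 * σ ((-τ) ^ γ • y)) ((-τ) ^ (-γ))
    simp only [rpow_smul_rpow_neg_smul hs] at key
    rw [key, finrank_euclideanSpace_fin, abs_inv_rpow_neg_pow_three hs, smul_eq_mul]
  rw [h2, ← mul_assoc, ← Real.rpow_add hs]
  congr 1
  ring_nf

/-- **Flux slice of the ansatz (exact scaling).**  For `τ < 0`, `u = selfSimilarCollapse γ 0 V`,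
`p = selfSimilarCollapsePressure γ 0 P` and a `C¹` function `σ`,
`∫ (|u|² + 2p)(τ,x) ⟪u(τ,x), ∇σ(x)⟫ dx = (−τ)^{6γ−3} ∫ (|V|² + 2P)(y) ⟪V(y), ∇σ((−τ)^γ y)⟫ dy`
(Chae–Shvydkoy 2013, the flux term of (2.8): exponent `(N−3α)/(1+α) = 6γ−3`). [cite: ChaeShvydkoy2013, §2.2 eq. (2.8)] -/
theorem integral_flux_selfSimilarCollapse (γ : ℝ) {τ : ℝ} (hτ : τ < 0)
    (V : EuclideanSpace ℝ (Fin 3) → EuclideanSpace ℝ (Fin 3)) (P : EuclideanSpace ℝ (Fin 3) → ℝ)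
    (σ : EuclideanSpace ℝ (Fin 3) → ℝ) :
    ∫ x, (‖selfSimilarCollapse γ 0 V τ x‖ ^ 2 + 2 * selfSimilarCollapsePressure γ 0 P τ x) *
        ⟪selfSimilarCollapse γ 0 V τ x, gradient σ x⟫ =
      (-τ) ^ (6 * γ - 3) * ∫ y, (‖V y‖ ^ 2 + 2 * P y) * ⟪V y, gradient σ ((-τ) ^ γ • y)⟫ := by
  have hs : 0 < -τ := neg_pos.2 hτ
  have h1 : ∀ x, (‖selfSimilarCollapse γ 0 V τ x‖ ^ 2 + 2 * selfSimilarCollapsePressure γ 0 P τ x) *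
        ⟪selfSimilarCollapse γ 0 V τ x, gradient σ x⟫ =
      (-τ) ^ (3 * (γ - 1)) * ((‖V ((-τ) ^ (-γ) • x)‖ ^ 2 + 2 * P ((-τ) ^ (-γ) • x)) *
        ⟪V ((-τ) ^ (-γ) • x), gradient σ x⟫) := by
    intro x
    rw [norm_selfSimilarCollapse hτ, selfSimilarCollapsePressure_apply, selfSimilarCollapse_apply,
      zero_sub, real_inner_smul_left, mul_pow, ← Real.rpow_natCast ((-τ) ^ (γ - 1)) 2,
      ← Real.rpow_mul hs.le, show (γ - 1) * ((2 : ℕ) : ℝ) = 2 * (γ - 1) by push_cast; ring]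
    have h3 : (-τ) ^ (3 * (γ - 1)) = (-τ) ^ (2 * (γ - 1)) * (-τ) ^ (γ - 1) := by
      rw [← Real.rpow_add hs]; congr 1; ring
    rw [h3]
    ring
  simp_rw [h1]
  rw [integral_const_mul]
  have h2 : ∫ x, (‖V ((-τ) ^ (-γ) • x)‖ ^ 2 + 2 * P ((-τ) ^ (-γ) • x)) *
        ⟪V ((-τ) ^ (-γ) • x), gradient σ x⟫ =
      (-τ) ^ (3 * γ) * ∫ y, (‖V y‖ ^ 2 + 2 * P y) * ⟪V y, gradient σ ((-τ) ^ γ • y)⟫ := by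
    have key := Measure.integral_comp_smul (volume : Measure (EuclideanSpace ℝ (Fin 3)))
      (fun y : EuclideanSpace ℝ (Fin 3) => (‖V y‖ ^ 2 + 2 * P y) * ⟪V y, gradient σ ((-τ) ^ γ • y)⟫)
      ((-τ) ^ (-γ))
    simp only [rpow_smul_rpow_neg_smul hs] at key
    rw [key, finrank_euclideanSpace_fin, abs_inv_rpow_neg_pow_three hs, smul_eq_mul]
  rw [h2, ← mul_assoc, ← Real.rpow_add hs]
  congr 1
  ring_nf

end Scaling

/-! ## The profile local energy inequality of exactly self-similar class members -/

section Profile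

/-- **Forward local energy inequality in profile variables (Chae–Shvydkoy's (2.9), forward
direction).**  Let `(u, p)` be a suitable weak ancient Euler pair on `(−∞,0) × ℝ³` (E's class:
`ν = 0`, `f = 0`) that is EXACTLY SELF-SIMILAR with exponent `γ` (`γ = 1/(2+ρ)` for E's gauge
exponent `ρ`): `u(τ) = selfSimilarCollapse γ 0 V τ`, `p(τ) = selfSimilarCollapsePressure γ 0 P τ`
for `τ < 0`.  Then for every smooth compactly supported `σ ≥ 0`, for a.e. `τ₁ < 0` and a.e.
`τ₂ ∈ (τ₁, 0)`:
`(−τ₂)^{5γ−2} ∫ |V|² σ((−τ₂)^γ ·) ≤ (−τ₁)^{5γ−2} ∫ |V|² σ((−τ₁)^γ ·)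
   + ∫_{τ₁}^{τ₂} (−τ)^{6γ−3} ∫ (|V|² + 2P) ⟪V, ∇σ((−τ)^γ ·)⟫ dτ`
— with `l = (−τ)^{−γ}`, `σ_l = σ(·/l)`: `l₂^{2ρ−1} ∫|V|²σ_{l₂} ≤ l₁^{2ρ−1} ∫|V|²σ_{l₁} + flux`,
CS13 (2.9) with `N − 2α = 1 − 2ρ`, in the ONE direction the local energy inequality provides.
This is the LEI input of rung C1 (exactly self-similar members) in profile variables. [cite: ChaeShvydkoy2013, §2.2 eq. (2.9)] -/
theorem selfSimilar_profile_energy_le_add_flux {γ : ℝ}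
    {u : ℝ → EuclideanSpace ℝ (Fin 3) → EuclideanSpace ℝ (Fin 3)}
    {p : ℝ → EuclideanSpace ℝ (Fin 3) → ℝ}
    (hsw : IsSuitableWeakSolutionOn (slab (EuclideanSpace ℝ (Fin 3)) (Iio 0) isOpen_Iio) 0 0 u p)
    {V : EuclideanSpace ℝ (Fin 3) → EuclideanSpace ℝ (Fin 3)} {P : EuclideanSpace ℝ (Fin 3) → ℝ}
    (hu : ∀ τ : ℝ, τ < 0 → u τ = selfSimilarCollapse γ 0 V τ)
    (hp : ∀ τ : ℝ, τ < 0 → p τ = selfSimilarCollapsePressure γ 0 P τ)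
    {σ : EuclideanSpace ℝ (Fin 3) → ℝ} (hσ : ContDiff ℝ (⊤ : ℕ∞) σ) (hσc : HasCompactSupport σ)
    (hσ0 : ∀ x, 0 ≤ σ x) :
    ∀ᵐ τ₁ : ℝ, τ₁ < 0 → ∀ᵐ τ₂ : ℝ, τ₂ ∈ Ioo τ₁ 0 →
      (-τ₂) ^ (5 * γ - 2) * ∫ y, ‖V y‖ ^ 2 * σ ((-τ₂) ^ γ • y) ≤
        ((-τ₁) ^ (5 * γ - 2) * ∫ y, ‖V y‖ ^ 2 * σ ((-τ₁) ^ γ • y)) +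
          ∫ τ in Ico τ₁ τ₂, (-τ) ^ (6 * γ - 3) *
            ∫ y, (‖V y‖ ^ 2 + 2 * P y) * ⟪V y, gradient σ ((-τ) ^ γ • y)⟫ := by
  have hu3 := locallyIntegrableOn_cube_of_suitable hsw
  filter_upwards [ae_energy_le_add_flux le_rfl hsw hσ hσc hσ0] with τ₁ hτ₁ hneg
  filter_upwards [hτ₁ hneg] with τ₂ hτ₂ hI
  have key := hτ₂ hI
  have hτ₂0 : τ₂ < 0 := hI.2
  -- the two slice energies
  rw [hu τ₂ hτ₂0, hu τ₁ hneg, integral_norm_sq_selfSimilarCollapse_mul γ hτ₂0,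
    integral_norm_sq_selfSimilarCollapse_mul γ hneg] at key
  refine key.trans (le_of_eq ?_)
  congr 1
  -- the flux: Fubini on `[τ₁, τ₂) × ℝ³`, then the slice scaling
  have hint : IntegrableOn (fun z : ℝ × EuclideanSpace ℝ (Fin 3) => ‖u z.1 z.2‖ ^ 2 * (0 * Δ σ z.2) +
      (‖u z.1 z.2‖ ^ 2 + 2 * p z.1 z.2) * ⟪u z.1 z.2, gradient σ z.2⟫)
      (Ico τ₁ τ₂ ×ˢ (univ : Set (EuclideanSpace ℝ (Fin 3)))) volume := by
    refine (SuitableRestart.integrableOn_energyRHS_Icc_prod hsw hu3 (a := τ₁ - 1) (b := 0) ?_ hσ hσc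
      (c₁ := τ₁) (c₂ := τ₂) fun t ht => ⟨by linarith [ht.1], lt_of_le_of_lt ht.2 hτ₂0⟩).mono_set
      (prod_mono Ico_subset_Icc_self subset_rfl)
    rintro ⟨t, x⟩ ⟨ht, -⟩
    rw [SetLike.mem_coe, mem_slab]
    exact ht.2
  rw [Measure.volume_eq_prod] at hint
  rw [Measure.volume_eq_prod, setIntegral_prod _ hint, Measure.restrict_univ]
  refine setIntegral_congr_fun measurableSet_Ico fun τ hτ => ?_
  have hτ0 : τ < 0 := hτ.2.trans hτ₂0
  simp only [zero_mul, mul_zero, zero_add]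
  rw [hu τ hτ0, hp τ hτ0]
  exact integral_flux_selfSimilarCollapse γ hτ0 V P σ

end Profile

end Summit.NavierStokesRegularity.NavierStokesRegularity.Theorems.PowerGaugeEulerLiouville
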